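import Summits.CriticalPhenomena.SAWScalingLimit.Theorems.SAWLoopFugacityFlowIsingBoundaryRatioWindowRectDefs
import HarnessLib

/-!
# Radial crossings pass through the window rectangle (definition, line `fk-anchor-transfer`, rev 8)
(crux `SAWLoopFugacityFlow.IsingBoundaryRatio`, stmt-CriticalPhenomena-10650)

A small definitions module next to `…IsingBoundaryRatioWindowRectDefs.lean` (imported, NOT modified) naming the
planar-topology TARGET used by the rim-to-rim instance of CDH16 Thm 1.1 (ii):

* `AnnCrossThroughWindowRect` — for small `δ`, in a finite volume containing the chart disc, every `ω`-open radial
  crossing `AnnCross` of the lattice conformal half-annulus contains an `ω`-open walk of the presented rectangle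
  `⟨E⟩` (`IsWindowRect … E d₀ n`) from a vertex of arc `1` to a vertex of arc `3` (the two arcs carrying the rim
  darts). Route of the eventual proof: every sub-walk of the crossing that crosses the inner band `[r₁', r₂']`
  meets a vertex of `E` — the sites of chart height `≥ 2ω(δ)` (`ω` = chart oscillation over a cell) belong to the
  bulk component, whose closure is in `E` (`IsWindowRect.bulk_mem`, `closed`), and a band crossing made of sites of
  smaller height is impossible: at each radius the chart semicircle descends from a bulk vertex of `E` through full
  cells to a cell meeting `∂D`, and the crossing, confined below, would have to cross that descent (crossing lemma
  in the chart, `Literature.Topology.PlaneTopology.exists_mem_of_crossing`) —; by `IsWindowRect.closed` the whole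
  band crossing then runs in `E`, it is entered through a rim dart of inner chart radius and, for the last ascent,
  left through a rim dart of outer chart radius, which `IsWindowRect.rim_darts` places on the arcs `1` and `3`.

The proposition is a TARGET of the line, not a cited fact; nothing is asserted.
-/

noncomputable section

open scoped Classical Topology
open Filter Set Metric SimpleGraph
open Literature.Probability.LatticeModels Literature.Probability.RandomPlanarGeometry
open Literature.Probability.Percolation (BondConfig)
open UpperHalfPlane (upperHalfPlaneSet)

namespace Summit.CriticalPhenomena.SAWScalingLimit.Theorems.IsingBoundaryRatio

/-- **Radial crossings pass through the window rectangle** (TARGET; see the module docstring): for the chordal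
chart `φ`, `M > 1`, `ε > 0` there is `ρ₀ > 0` such that for every `ρ < ρ₀`, all radii
`ρ < r₁ < r₁' < r₂' < r₂ < Mρ`, all small `δ`, every finite volume `Λ` agreeing locally with `Ω_δ` in `B(a, ε)` and
containing the chart disc of radius `Mρ`, every presentation `IsWindowRect D φ M ε δ ρ r₁ r₂ r₁' r₂' Λ E d₀ n` and
every configuration `ω`, an `ω`-open radial crossing `AnnCross` of the annulus `(ρ, Mρ)` yields a walk of `⟨E⟩`
from a vertex of arc `1` to a vertex of arc `3` all of whose edges, read in `Λ`, are in `ω`. -/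
def AnnCrossThroughWindowRect : Prop :=
  ∀ (D : DobrushinDomain) (φ : ConformalEquiv upperHalfPlaneSet D.carrier),
    D.IsChordalUniformizing φ → ∀ (M : ℝ), 1 < M → ∀ (ε : ℝ), 0 < ε →
      ∃ ρ₀ : ℝ, 0 < ρ₀ ∧ ∀ (ρ : ℝ), 0 < ρ → ρ < ρ₀ → ∀ (r₁ r₁' r₂' r₂ : ℝ),
        ρ < r₁ → r₁ < r₁' → r₁' < r₂' → r₂' < r₂ → r₂ < M * ρ →
        ∀ᶠ δ in 𝓝[>] (0 : ℝ), ∀ (Λ : Finset (Site 2)),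
          LocalAgreement D.carrier (D.pt 0) ε δ (discreteDomainGraph D.carrier δ) Λ →
          (∀ x ∈ meshDomain D.carrier δ, ‖φ.symm (meshPoint δ x)‖ < M * ρ → x ∈ Λ) →
          ∀ (E : Finset (Sym2 (Site 2))) (d₀ : Site 2 × Fin 4) (n : Fin 4 → ℕ),
            IsWindowRect D φ M ε δ ρ r₁ r₂ r₁' r₂' Λ E d₀ n →
              let H : SimpleGraph Λ := (discreteDomainGraph D.carrier δ).comap Subtype.val
              ∀ ω : BondConfig Λ, AnnCross H (annIn D φ ε δ ρ Λ) (annBody D φ M ε δ ρ Λ) ω →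
                ∃ (u v : Site 2), u ∈ DiscreteRect.arcVerts E d₀ n 1 ∧ v ∈ DiscreteRect.arcVerts E d₀ n 3 ∧
                  ∃ p : (SimpleGraph.fromEdgeSet (↑E : Set (Sym2 (Site 2)))).Walk u v,
                    ∀ e ∈ p.edges, ∃ (x y : Site 2) (hx : x ∈ Λ) (hy : y ∈ Λ),
                      e = s(x, y) ∧ s((⟨x, hx⟩ : ↥Λ), ⟨y, hy⟩) ∈ ω

/-- In a presented window rectangle, a vertex of arc `0` lies in the finite volume (registered sub-goal of
stmt-CriticalPhenomena-10650; immediate from `IsWindowRect.arc0_sub`). [folklore] -/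
theorem mem_of_mem_arcVerts_zero : ∀ (D : DobrushinDomain) (φ : ConformalEquiv upperHalfPlaneSet D.carrier) (M ε δ ρ r₁ r₂ r₁' r₂' : ℝ) (Λ : Finset (Site 2)) (E : Finset (Sym2 (Site 2))) (d₀ : Site 2 × Fin 4) (n : Fin 4 → ℕ), IsWindowRect D φ M ε δ ρ r₁ r₂ r₁' r₂' Λ E d₀ n → ∀ x ∈ DiscreteRect.arcVerts E d₀ n 0, x ∈ Λ :=
  fun _ _ _ _ _ _ _ _ _ _ _ _ _ _ h x hx => (h.arc0_sub x hx).1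

end Summit.CriticalPhenomena.SAWScalingLimit.Theorems.IsingBoundaryRatio

end
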